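import Literature.NumberTheory.Transcendental.LWMeasureZeroFree
import HarnessLib

/-!
# The auxiliary polynomials of the Lindemann–Weierstrass measure (Ably 1994, §II, Lemme 3) — conclusion by Liouville's inequality

`Literature/NumberTheory/Transcendental/LWMeasureZeroFreeFinal.lean` — proofs only, no named
facts, no definitions. Sixth file of the proof of Ably's "Proposition principale" behind
`Ably1994_lindemannWeierstrass_measure`: the last lines of the proof of Lemme 3 (pp. 39–40).
The contrapositive core `Setup.exists_relation_of_vanishing` (`LWMeasureZeroFree.lean`) turns a
common zero `(α, z)` of all `Q_{s,h,j}` (`s < T`, `h ∈ [0,M)ⁿ`) with `|z_k − e^{y_k}| ≤ e^{−r}`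
into a non-zero `μ ∈ ℤⁿ` with `|μ_k| ≤ (D−1)B²Δ` and
`|∑ μ_k y_k| ≤ (D−1)²B²Δ e^{−V}`, `e^{−V} = (3/2)(1 + ∑_k |e^{−y_k}|) e^{−r}` (the logarithms
`ỹ_k` of `z_k`, `Setup.wlog`, being `e^{−V}`-close to the `y_k`, `Setup.norm_wlog_sub_le`).
Since the `y_k` are `ℚ`-linearly independent algebraic numbers, Liouville's inequality
`c_L ≤ (∑|μ_k|)^{k_L} |∑ μ_k y_k|` (`LWMeasure.exists_lowerBound_linearForm`,
`LWMeasureAlgebraicData.lean`) is violated as soon as `r ≥ r₀ + k₀ log(DM)`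
(`Setup.no_common_zero_near`; in Ably's wording, p. 40, the subgroup `G'` of (7) is excluded in
both cases `G'₁ = 𝔾ₐ`, `G'₁ = 0` by (C₄), (C₃)).

## References

* [Ably1994] M. Ably, *Une version quantitative du théorème de Lindemann–Weierstrass*, Acta Arith.
  67 (1994) 29–45, §II Lemme 3 pp. 39–40.
* [NesterenkoPhilippon2001] Yu. V. Nesterenko, P. Philippon (eds.), LNM 1752 (2001), Ch. 14
  §3.3, p. 258 (Liouville's inequality).
-/

noncomputable section

open MvPolynomial Finset Complex

namespace Literature.NumberTheory.Transcendental

namespace LWMeasure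

namespace Setup

/-- `e^{-x} ≤ 1/(1+x)` for `x ≥ 0`. [folklore] -/
private theorem exp_neg_le_one_div {x : ℝ} (hx : 0 ≤ x) : Real.exp (-x) ≤ 1 / (1 + x) := by
  rw [Real.exp_neg, one_div]
  exact inv_anti₀ (by linarith) (by linarith [Real.add_one_le_exp x])

/-- `P^N e^{-r} ≤ e^{-r₀}` when `r ≥ r₀ + N log P` (`P > 0`). [folklore] -/
private theorem pow_mul_exp_neg_le {P r r₀ : ℝ} {N : ℕ} (hP : 0 < P)
    (hr : r₀ + N * Real.log P ≤ r) : P ^ N * Real.exp (-r) ≤ Real.exp (-r₀) := by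
  have h1 : Real.exp (-r) ≤ Real.exp (-r₀ - N * Real.log P) := Real.exp_le_exp.mpr (by linarith)
  rw [Real.exp_sub, Real.exp_nat_mul, Real.exp_log hP] at h1
  rwa [le_div_iff₀ (pow_pos hP N), mul_comm] at h1

/-- **Lemme 3 (no common zero near `θ`).** There are `c_z ∈ ℕ` and reals `r₀`, `k₀ ≥ 0`
(depending on `y₁, …, yₙ` only) such that for all parameters with `L, D ≥ 2`, `B ≥ 1`, `2B < M`,
`2T_z + 1 ≤ T`, (C₃) `c_z(L−1)(D−1) < (T_z+1)(B+1)ⁿ`, (C₄) `c_z(D−1) < (T_z+1)(B+1)^{n−1}`, and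
every `r ≥ r₀ + k₀ log(DM)`, the polynomials `Q_{s,h,j}` (`s < T`, `h ∈ [0,M)ⁿ`, `j` the minimal
index at `(α, z)`) have no common zero `(α, z)` with `|z_k − e^{y_k}| ≤ e^{−r}`: the small
non-trivial relation `|∑ μ_k y_k| ≤ (D−1)²B²Δe^{−V}`, `|μ_k| ≤ (D−1)B²Δ` produced by the zero
estimate (`Setup.exists_relation_of_vanishing`) contradicts Liouville's inequality for the
`ℚ`-linearly independent algebraic `y_k` (`LWMeasure.exists_lowerBound_linearForm`).
[cite: Ably1994, §II Lemme 3 pp. 39–40] -/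
theorem no_common_zero_near (S : Setup) :
    ∃ (cz : ℕ) (r₀ k₀ : ℝ), 0 ≤ k₀ ∧ ∀ (L D b M T B Tz : ℕ) (p : Unk S.n L D b → ℤ)
      (z : Fin S.n → ℂ) (j : Fin (S.n + 1) →₀ ℕ) (r : ℝ),
      2 ≤ L → 2 ≤ D → 1 ≤ B → 2 * B < M → 2 * Tz + 1 ≤ T →
      cz * (L - 1) * (D - 1) < (Tz + 1) * (B + 1) ^ S.n →
      cz * (D - 1) < (Tz + 1) * (B + 1) ^ (S.n - 1) →
      r₀ + k₀ * Real.log ((D : ℝ) * M) ≤ r →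
      (∀ k, ‖z k - S.θ k‖ ≤ Real.exp (-r)) →
      S.IsMinIdx p (Fin.cons S.α z) j →
      (∀ h : Fin S.n → ℕ, (∀ k, h k < M) → ∀ s < T,
        MvPolynomial.aeval (Fin.cons S.α z : Fin (S.n + 1) → ℂ) (S.Qj p h s j) = 0) →
      False := by
  obtain ⟨cz, hcz⟩ := S.exists_relation_of_vanishing
  obtain ⟨cL, hcL, kL, hLiou⟩ := exists_lowerBound_linearForm S.y S.alg S.li
  -- the constants
  set Cexp : ℝ := 1 + ∑ k, ‖cexp (-S.y k)‖ with hCexp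
  set Δ₁ : ℝ := Real.pi * (1 + ‖S.y ⟨0, S.one_le_n⟩‖) + ∑ k, ‖S.y k‖ + S.n with hΔ₁
  set K₀ : ℝ := (S.n : ℝ) ^ kL * Δ₁ ^ (kL + 1) * (3 / 2 * Cexp) with hK₀
  set N : ℕ := 2 * kL + 3 with hN
  set r₀ : ℝ := (∑ k, ‖S.y k‖) + 2 * Cexp + K₀ / cL with hr₀
  have hE0 : 0 ≤ ∑ k, ‖cexp (-S.y k)‖ := sum_nonneg fun k _ => norm_nonneg _
  have hCexp1 : 1 ≤ Cexp := le_add_of_nonneg_right hE0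
  have hCexp0 : 0 < Cexp := one_pos.trans_le hCexp1
  have hy0 : 0 ≤ ∑ k, ‖S.y k‖ := sum_nonneg fun k _ => norm_nonneg _
  have hpi1 : Real.pi * (1 + ‖S.y ⟨0, S.one_le_n⟩‖) =
      Real.pi + Real.pi * ‖S.y ⟨0, S.one_le_n⟩‖ := by ring
  have hpiy0 : 0 ≤ Real.pi * ‖S.y ⟨0, S.one_le_n⟩‖ := mul_nonneg Real.pi_pos.le (norm_nonneg _)
  have hn0 : 0 ≤ (S.n : ℝ) := Nat.cast_nonneg _
  have hΔpi : Real.pi ≤ Δ₁ := by rw [hΔ₁, hpi1]; linarith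
  have hΔy : Real.pi * ‖S.y ⟨0, S.one_le_n⟩‖ ≤ Δ₁ := by rw [hΔ₁, hpi1]; linarith [Real.pi_pos]
  have hΔ0 : 0 ≤ Δ₁ := Real.pi_pos.le.trans hΔpi
  have hK₀0 : 0 ≤ K₀ := mul_nonneg (mul_nonneg (pow_nonneg hn0 _) (pow_nonneg hΔ0 _))
    (mul_nonneg (by norm_num) hCexp0.le)
  have hKc : 0 ≤ K₀ / cL := div_nonneg hK₀0 hcL.le
  have hr₀0 : 0 ≤ r₀ := add_nonneg (add_nonneg hy0 (mul_nonneg zero_le_two hCexp0.le)) hKc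
  refine ⟨cz, r₀, (N : ℝ), Nat.cast_nonneg N, ?_⟩
  intro L D b M T B Tz p z j r hL hD hB hBM hTz hC3 hC4 hr hz hj hvan
  -- the size of `P = DM`
  have hD1 : (1 : ℝ) ≤ D := by exact_mod_cast (by omega : 1 ≤ D)
  have hM1 : (1 : ℝ) ≤ M := by exact_mod_cast (by omega : 1 ≤ M)
  have hBM' : (B : ℝ) ≤ M := by exact_mod_cast (by omega : B ≤ M)
  have hDm1 : ((D - 1 : ℕ) : ℝ) ≤ D := by exact_mod_cast Nat.sub_le D 1
  set P : ℝ := (D : ℝ) * M with hP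
  have hP1 : 1 ≤ P := by rw [hP]; nlinarith
  have hP0 : 0 < P := one_pos.trans_le hP1
  have hDP : ((D - 1 : ℕ) : ℝ) ≤ P :=
    hDm1.trans (by rw [hP]; exact le_mul_of_one_le_right (zero_le_one.trans hD1) hM1)
  have hlog0 : 0 ≤ Real.log P := Real.log_nonneg hP1
  have hr₀r : r₀ ≤ r := (le_add_of_nonneg_right (mul_nonneg (Nat.cast_nonneg N) hlog0)).trans hr
  have hexpr : Real.exp (-r) ≤ 1 / (1 + r₀) :=
    (Real.exp_le_exp.mpr (neg_le_neg hr₀r)).trans (exp_neg_le_one_div hr₀0)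
  -- `e^{-r} C_exp ≤ 1/2`
  have h2 : Real.exp (-r) * Cexp ≤ 1 / 2 := by
    have h1r : 2 * Cexp ≤ 1 + r₀ := by rw [hr₀]; linarith
    calc Real.exp (-r) * Cexp ≤ 1 / (1 + r₀) * Cexp :=
          mul_le_mul_of_nonneg_right hexpr hCexp0.le
      _ ≤ 1 / 2 := by
          rw [div_mul_eq_mul_div, one_mul, div_le_iff₀ (by linarith : (0 : ℝ) < 1 + r₀)]
          linarith
  -- `z_k ≠ 0`
  have hz0 : ∀ k, z k ≠ 0 := by
    intro k hk
    have h1 := hz k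
    rw [hk, zero_sub, norm_neg, θ_apply, Complex.norm_exp, Real.exp_le_exp] at h1
    have h3 := Complex.abs_re_le_norm (S.y k)
    have h4 : ‖S.y k‖ ≤ ∑ k, ‖S.y k‖ :=
      single_le_sum (f := fun k => ‖S.y k‖) (fun k _ => norm_nonneg _) (mem_univ k)
    have h5 : (∑ k, ‖S.y k‖) + 2 ≤ r₀ := by rw [hr₀]; linarith
    rw [abs_le] at h3
    linarith [h3.1]
  -- the logarithms `ỹ_k` of the `z_k`
  have hek : ∀ k, ‖cexp (-S.y k)‖ ≤ Cexp := fun k =>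
    (single_le_sum (f := fun k => ‖cexp (-S.y k)‖) (fun k _ => norm_nonneg _)
      (mem_univ k)).trans (le_add_of_nonneg_left zero_le_one)
  have hsmall : ∀ k, ‖z k - S.θ k‖ * ‖cexp (-S.y k)‖ ≤ Real.exp (-r) * ‖cexp (-S.y k)‖ :=
    fun k => mul_le_mul_of_nonneg_right (hz k) (norm_nonneg _)
  have hsmall' : ∀ k, Real.exp (-r) * ‖cexp (-S.y k)‖ ≤ 1 / 2 := fun k =>
    (mul_le_mul_of_nonneg_left (hek k) (Real.exp_pos _).le).trans h2
  have hwlog : ∀ k, ‖S.wlog z k - S.y k‖ ≤ 3 / 2 * (Real.exp (-r) * ‖cexp (-S.y k)‖) :=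
    fun k => (S.norm_wlog_sub_le k ((hsmall k).trans (hsmall' k))).trans
      (mul_le_mul_of_nonneg_left (hsmall k) (by norm_num))
  set eV : ℝ := 3 / 2 * (Real.exp (-r) * Cexp) with heV
  have heV0 : 0 < eV := mul_pos (by norm_num) (mul_pos (Real.exp_pos _) hCexp0)
  have hVsum : ∑ k, ‖S.wlog z k - S.y k‖ ≤ Real.exp (-(-Real.log eV)) := by
    rw [neg_neg, Real.exp_log heV0]
    calc ∑ k, ‖S.wlog z k - S.y k‖ ≤ ∑ k, 3 / 2 * (Real.exp (-r) * ‖cexp (-S.y k)‖) :=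
          sum_le_sum fun k _ => hwlog k
      _ = 3 / 2 * (Real.exp (-r) * ∑ k, ‖cexp (-S.y k)‖) := by rw [mul_sum, mul_sum]
      _ ≤ eV := by
          have : ∑ k, ‖cexp (-S.y k)‖ ≤ Cexp := le_add_of_nonneg_left zero_le_one
          rw [heV]
          gcongr
  have hΔw : ∑ k, ‖S.wlog z k‖ ≤ Δ₁ := by
    calc ∑ k, ‖S.wlog z k‖ ≤ ∑ k, (‖S.y k‖ + 1) := sum_le_sum fun k _ => by
            have h1 := norm_add_le (S.y k) (S.wlog z k - S.y k)
            rw [add_sub_cancel] at h1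
            linarith [hwlog k, hsmall' k]
      _ = ∑ k, ‖S.y k‖ + S.n := by
          rw [sum_add_distrib, sum_const, card_univ, Fintype.card_fin, nsmul_eq_mul, mul_one]
      _ ≤ Δ₁ := by rw [hΔ₁, hpi1]; linarith [Real.pi_pos]
  -- Lemme 3 (zero estimate): a small non-trivial integer relation among the `y_k`
  obtain ⟨mu, hmu0, hmuB, hrel⟩ := hcz L D b M T B Tz p z j (-Real.log eV) Δ₁ hz0 hj hVsum hΔw
    hΔpi hΔy hL hD hB hBM hTz hvan hC3 hC4
  rw [neg_neg, Real.exp_log heV0] at hrel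
  -- Liouville's inequality
  have hLi := hLiou mu hmu0
  set X : ℝ := ((D - 1 : ℕ) : ℝ) * (B : ℝ) ^ 2 * Δ₁ with hX
  have hX0 : 0 ≤ X := mul_nonneg (mul_nonneg (Nat.cast_nonneg _) (sq_nonneg _)) hΔ0
  have hXP : X ≤ P ^ 2 * Δ₁ := by
    rw [hX, hP, mul_pow]
    refine mul_le_mul_of_nonneg_right ?_ hΔ0
    calc ((D - 1 : ℕ) : ℝ) * (B : ℝ) ^ 2 ≤ D * (M : ℝ) ^ 2 := by gcongr
      _ ≤ (D : ℝ) ^ 2 * (M : ℝ) ^ 2 :=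
          mul_le_mul_of_nonneg_right (le_self_pow₀ hD1 two_ne_zero) (sq_nonneg _)
  have hsum_mu : ∑ i, |(mu i : ℝ)| ≤ S.n * (P ^ 2 * Δ₁) := by
    calc ∑ i, |(mu i : ℝ)| ≤ ∑ _i : Fin S.n, X := sum_le_sum fun i _ => hmuB i
      _ = S.n * X := by rw [sum_const, card_univ, Fintype.card_fin, nsmul_eq_mul]
      _ ≤ S.n * (P ^ 2 * Δ₁) := mul_le_mul_of_nonneg_left hXP hn0
  have hrel' : ‖∑ k, (mu k : ℂ) * S.y k‖ ≤ P * (P ^ 2 * Δ₁) * eV := by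
    calc ‖∑ k, (mu k : ℂ) * S.y k‖ ≤ ((D - 1 : ℕ) : ℝ) ^ 2 * (B : ℝ) ^ 2 * Δ₁ * eV := hrel
      _ = ((D - 1 : ℕ) : ℝ) * X * eV := by rw [hX]; ring
      _ ≤ P * (P ^ 2 * Δ₁) * eV := by gcongr
  have hfinal : cL ≤ K₀ * (P ^ N * Real.exp (-r)) := by
    calc cL ≤ (∑ i, |(mu i : ℝ)|) ^ kL * ‖∑ i, (mu i : ℂ) * S.y i‖ := hLi
      _ ≤ ((S.n : ℝ) * (P ^ 2 * Δ₁)) ^ kL * (P * (P ^ 2 * Δ₁) * eV) :=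
          mul_le_mul (pow_le_pow_left₀ (sum_nonneg fun i _ => abs_nonneg _) hsum_mu kL) hrel'
            (norm_nonneg _) (pow_nonneg (mul_nonneg hn0 (mul_nonneg (pow_nonneg hP0.le 2) hΔ0)) kL)
      _ = K₀ * (P ^ N * Real.exp (-r)) := by rw [hK₀, hN, heV]; ring
  have hlt : K₀ * (P ^ N * Real.exp (-r)) < cL := by
    calc K₀ * (P ^ N * Real.exp (-r)) ≤ K₀ * (1 / (1 + r₀)) :=
          mul_le_mul_of_nonneg_left ((pow_mul_exp_neg_le hP0 hr).trans
            (exp_neg_le_one_div hr₀0)) hK₀0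
      _ < cL := by
          rw [mul_one_div, div_lt_iff₀ (by linarith : (0 : ℝ) < 1 + r₀)]
          have h1 : cL * (K₀ / cL) = K₀ := mul_div_cancel₀ K₀ hcL.ne'
          have h2 : K₀ / cL ≤ r₀ := by rw [hr₀]; linarith
          have h3 : cL * (K₀ / cL) ≤ cL * r₀ := mul_le_mul_of_nonneg_left h2 hcL.le
          linarith
  exact absurd hfinal (not_le.mpr hlt)

end Setup

end LWMeasure

end Literature.NumberTheory.Transcendental

end
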